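import Mathlib
import Summits.Ventures.PercRepro2.TwoCopyBHK
import Summits.Ventures.PercRepro2.ThreeMarkTyped
import Summits.Ventures.PercRepro2.MixedBHKMinRow

/-!
# The typed (two-copy) forms of the two class rows of `MinRowBHK`, and (W-ROW-MIN) from them
(blind cell PercRepro2, night-3 g22, 2026-08-28; `proofs/NIGHT3-CERT.md` §31.7)

For an edge `e` the class rows of `MinRowBHK` — `Φ₁₁ ≤ M` (census-true at every edge touching
`a₁` or `a₂`) and `Φ₀₀ ≤ M` (census-true at every edge touching `o` or `b`) — are the bilinear forms
of two kernels on `Config E × Config E` that ignore the `e`-coordinates: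

  `K^R(x, y) = 2·K(x[e ↦ 0], y[e ↦ 1]) − K(x[e ↦ 1], y[e ↦ 1])`,
  `K^M(x, y) = 2·K(x[e ↦ 0], y[e ↦ 1]) − K(x[e ↦ 0], y[e ↦ 0])`,

`K = crossKernelBoth` = the two halves of p1's cross-cluster BHK kernel (`TwoCopyBHK.lean`):
`biForm p p K^R = 2(M − Φ₁₁)`, `biForm p p K^M = 2(M − Φ₀₀)` (`biForm_rootRowKernel`,
`biForm_markRowKernel`; the pinned laws appear through `biForm_update_pair`).  Hence p1's reduction
`disSum_nonneg_of_pinnedCount` turns the complementary-pair counts of `K^R` / `K^M` on all minors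
(`RootRowCount`, `MarkRowCount`: the two-copy Bernstein coefficients of `M − Φ₁₁` / `M − Φ₀₀` in the
edges other than `e`; census night-3 g22: 0 negative on every abstract instance with ≤ 7 mixed edges
besides `e` — 43,449,695 + 21,877,287 instances at 7, kits j314082 / j314083 — and on 5,392 + 2,972
nonzero random patterns) into the rows (`phi11_le_M_of_rootRowCount`, `phi00_le_M_of_markRowCount`),
into `MinRowBHK` when every edge has one of the two counts (`minRowBHK_of_counts`), and into
(W-ROW-MIN) at every edge of every `a₃`-inactive instance (`wrowMin_of_a3Inactive_of_counts`).
Own work; standard axioms.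
-/

namespace Summit.Ventures.PercRepro2

open UnionCluster

namespace CovForm

section MinRowTyped

open A3Inactive

variable {V : Type*} {E : Type*} [Fintype E] [DecidableEq E] [Fintype V] [DecidableEq V]
  {R : Type*} [Field R] [LinearOrder R] [IsStrictOrderedRing R]

/-! ## The bilinear form through a pinned pair -/

omit [Fintype V] [DecidableEq V] [LinearOrder R] [IsStrictOrderedRing R] in
/-- `biForm q q′ K = E_q[E_{q′}[K(x, y)]]`. -/
lemma biForm_eq_expect_expect (q q' : E → R) (K : Config E → Config E → R) :
    biForm q q' K = expect q (fun x => expect q' (fun y => K x y)) := by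
  unfold biForm expect
  refine Finset.sum_congr rfl fun x _ => ?_
  rw [Finset.mul_sum]
  refine Finset.sum_congr rfl fun y _ => ?_
  ring

omit [Fintype V] [DecidableEq V] [LinearOrder R] [IsStrictOrderedRing R] in
/-- The bilinear form of a kernel read through `e`-pinned configurations is the bilinear form of
the two pinned laws. -/
lemma biForm_update_pair (p : E → R) (K : Config E → Config E → R) (e : E) (s t : Bool) :
    biForm p p (fun x y => K (Function.update x e s) (Function.update y e t)) =
      biForm (Function.update p e (if s then 1 else 0)) (Function.update p e (if t then 1 else 0))
        K := by
  rw [biForm_eq_expect_expect, biForm_eq_expect_expect]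
  cases s <;> cases t <;>
    simp only [Bool.false_eq_true, ↓reduceIte, expect_update_zero, expect_update_one]

omit [Fintype V] [DecidableEq V] [LinearOrder R] [IsStrictOrderedRing R] in
/-- `biForm` is additive in the kernel. -/
lemma biForm_add (q q' : E → R) (K₁ K₂ : Config E → Config E → R) :
    biForm q q' (fun x y => K₁ x y + K₂ x y) = biForm q q' K₁ + biForm q q' K₂ := by
  unfold biForm
  rw [← Finset.sum_add_distrib]
  refine Finset.sum_congr rfl fun x _ => ?_
  rw [← Finset.sum_add_distrib]
  refine Finset.sum_congr rfl fun y _ => ?_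
  ring

/-! ## Both halves of the cross-cluster kernel and the two slacks -/

/-- Both halves of p1's cross-cluster BHK kernel: `(b ∈ C₁, o ∈ C₂)` and `(o ∈ C₁, b ∈ C₂)`. -/
noncomputable def crossKernelBoth (ends : E → Sym2 V) (o a₁ a₂ b : V) (x y : Config E) : R :=
  crossKernel ends a₁ a₂ b o x y + crossKernel ends a₁ a₂ o b x y

omit [Fintype V] [DecidableEq V] [LinearOrder R] [IsStrictOrderedRing R] in
/-- `biForm q q′ crossKernelBoth` in the masses of the two laws. -/
lemma biForm_crossKernelBoth (q q' : E → R) (ends : E → Sym2 V) (o a₁ a₂ b : V) :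
    biForm q q' (crossKernelBoth ends o a₁ a₂ b) =
      (prob q (avoidAll ends a₂ {a₁} ∩ connEvent ends a₁ b) *
            prob q' (avoidAll ends a₂ {a₁} ∩ connEvent ends a₂ o) +
          prob q (avoidAll ends a₂ {a₁} ∩ connEvent ends a₂ o) *
            prob q' (avoidAll ends a₂ {a₁} ∩ connEvent ends a₁ b) -
          prob q (avoidAll ends a₂ {a₁} ∩ (connEvent ends a₂ o ∩ connEvent ends a₁ b)) *
            prob q' (avoidAll ends a₂ {a₁}) -
          prob q (avoidAll ends a₂ {a₁}) *
            prob q' (avoidAll ends a₂ {a₁} ∩ (connEvent ends a₂ o ∩ connEvent ends a₁ b))) +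
        (prob q (avoidAll ends a₂ {a₁} ∩ connEvent ends a₁ o) *
            prob q' (avoidAll ends a₂ {a₁} ∩ connEvent ends a₂ b) +
          prob q (avoidAll ends a₂ {a₁} ∩ connEvent ends a₂ b) *
            prob q' (avoidAll ends a₂ {a₁} ∩ connEvent ends a₁ o) -
          prob q (avoidAll ends a₂ {a₁} ∩ (connEvent ends a₁ o ∩ connEvent ends a₂ b)) *
            prob q' (avoidAll ends a₂ {a₁}) -
          prob q (avoidAll ends a₂ {a₁}) *
            prob q' (avoidAll ends a₂ {a₁} ∩ (connEvent ends a₁ o ∩ connEvent ends a₂ b))) := by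
  unfold crossKernelBoth
  rw [biForm_add, biForm_crossKernel, biForm_crossKernel, RootEdge.avoidAll_singleton_eq_compl]
  have e1 : (connEvent ends a₁ a₂)ᶜ ∩ connEvent ends a₁ b ∩ connEvent ends a₂ o =
      (connEvent ends a₁ a₂)ᶜ ∩ (connEvent ends a₂ o ∩ connEvent ends a₁ b) := by
    ext; simp only [Set.mem_inter_iff]; tauto
  have e2 : (connEvent ends a₁ a₂)ᶜ ∩ connEvent ends a₁ o ∩ connEvent ends a₂ b =
      (connEvent ends a₁ a₂)ᶜ ∩ (connEvent ends a₁ o ∩ connEvent ends a₂ b) := by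
    ext; simp only [Set.mem_inter_iff]; tauto
  rw [e1, e2]

/-! ## The two class kernels -/

/-- The root-row kernel `K^R(x, y) = 2·K(x[e ↦ 0], y[e ↦ 1]) − K(x[e ↦ 1], y[e ↦ 1])`
(`biForm p p K^R = 2 (M − Φ₁₁)`). -/
noncomputable def rootRowKernel (ends : E → Sym2 V) (o a₁ a₂ b : V) (e : E) (x y : Config E) :
    R :=
  2 * crossKernelBoth ends o a₁ a₂ b (Function.update x e false) (Function.update y e true) -
    crossKernelBoth ends o a₁ a₂ b (Function.update x e true) (Function.update y e true)

/-- The mark-row kernel `K^M(x, y) = 2·K(x[e ↦ 0], y[e ↦ 1]) − K(x[e ↦ 0], y[e ↦ 0])`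
(`biForm p p K^M = 2 (M − Φ₀₀)`). -/
noncomputable def markRowKernel (ends : E → Sym2 V) (o a₁ a₂ b : V) (e : E) (x y : Config E) :
    R :=
  2 * crossKernelBoth ends o a₁ a₂ b (Function.update x e false) (Function.update y e true) -
    crossKernelBoth ends o a₁ a₂ b (Function.update x e false) (Function.update y e false)

omit [Fintype V] [DecidableEq V] [LinearOrder R] [IsStrictOrderedRing R] in
/-- `biForm p p K^R = 2·(M − Φ₁₁)`. -/
theorem biForm_rootRowKernel (p : E → R) (ends : E → Sym2 V) (o a₁ a₂ b : V) (e : E) :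
    biForm p p (rootRowKernel ends o a₁ a₂ b e) =
      2 * (mixedSlack p ends o a₁ a₂ b e - bhkSlack (Function.update p e 1) ends o a₁ a₂ b) := by
  have h1 : biForm p p (rootRowKernel ends o a₁ a₂ b e) =
      2 * biForm p p (fun x y => crossKernelBoth ends o a₁ a₂ b (Function.update x e false)
          (Function.update y e true)) -
        biForm p p (fun x y => crossKernelBoth ends o a₁ a₂ b (Function.update x e true)
          (Function.update y e true)) := by
    unfold biForm rootRowKernel
    rw [Finset.mul_sum, ← Finset.sum_sub_distrib]
    refine Finset.sum_congr rfl fun x _ => ?_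
    rw [Finset.mul_sum, ← Finset.sum_sub_distrib]
    refine Finset.sum_congr rfl fun y _ => ?_
    ring
  rw [h1, biForm_update_pair, biForm_update_pair]
  simp only [Bool.false_eq_true, ↓reduceIte]
  rw [biForm_crossKernelBoth, biForm_crossKernelBoth]
  unfold mixedSlack bhkSlack
  ring

omit [Fintype V] [DecidableEq V] [LinearOrder R] [IsStrictOrderedRing R] in
/-- `biForm p p K^M = 2·(M − Φ₀₀)`. -/
theorem biForm_markRowKernel (p : E → R) (ends : E → Sym2 V) (o a₁ a₂ b : V) (e : E) :
    biForm p p (markRowKernel ends o a₁ a₂ b e) =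
      2 * (mixedSlack p ends o a₁ a₂ b e - bhkSlack (Function.update p e 0) ends o a₁ a₂ b) := by
  have h1 : biForm p p (markRowKernel ends o a₁ a₂ b e) =
      2 * biForm p p (fun x y => crossKernelBoth ends o a₁ a₂ b (Function.update x e false)
          (Function.update y e true)) -
        biForm p p (fun x y => crossKernelBoth ends o a₁ a₂ b (Function.update x e false)
          (Function.update y e false)) := by
    unfold biForm markRowKernel
    rw [Finset.mul_sum, ← Finset.sum_sub_distrib]
    refine Finset.sum_congr rfl fun x _ => ?_
    rw [Finset.mul_sum, ← Finset.sum_sub_distrib]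
    refine Finset.sum_congr rfl fun y _ => ?_
    ring
  rw [h1, biForm_update_pair, biForm_update_pair]
  simp only [Bool.false_eq_true, ↓reduceIte]
  rw [biForm_crossKernelBoth, biForm_crossKernelBoth]
  unfold mixedSlack bhkSlack
  ring

/-! ## The typed candidates and the rows from them -/

/-- **`RootRowCount`, a CANDIDATE (NOT claimed proved)**: every complementary-pair count of the
root-row kernel at `e` is nonnegative — the two-copy Bernstein coefficients of `M − Φ₁₁` in the edges
other than `e`.  Census-true at every edge touching `a₁` or `a₂` (0 negative on all abstract
instances with ≤ 7 mixed edges besides `e`, kit j314082; FALSE at `o`/`b`-edges in general, where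
`M ≥ Φ₁₁` fails). -/
def RootRowCount (ends : E → Sym2 V) (o a₁ a₂ b : V) (e : E) : Prop :=
  ∀ (G : Finset E) (z : Config E), 0 ≤ pinnedCount G z (rootRowKernel (R := R) ends o a₁ a₂ b e)

/-- **`MarkRowCount`, a CANDIDATE (NOT claimed proved)**: the same for the mark-row kernel
(`M − Φ₀₀`); census-true at every edge touching `o` or `b` (kit j314083). -/
def MarkRowCount (ends : E → Sym2 V) (o a₁ a₂ b : V) (e : E) : Prop :=
  ∀ (G : Finset E) (z : Config E), 0 ≤ pinnedCount G z (markRowKernel (R := R) ends o a₁ a₂ b e)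

omit [Fintype V] [DecidableEq V] in
/-- **`Φ₁₁ ≤ M` at `e` from the typed root-row count.** -/
theorem phi11_le_M_of_rootRowCount {ends : E → Sym2 V} {o a₁ a₂ b : V} {e : E}
    (h : RootRowCount (R := R) ends o a₁ a₂ b e) (p : E → R) (hp : IsProbVec p) :
    bhkSlack (Function.update p e 1) ends o a₁ a₂ b ≤ mixedSlack p ends o a₁ a₂ b e := by
  have hd := disSum_nonneg_of_pinnedCount (rootRowKernel (R := R) ends o a₁ a₂ b e) h p
    (fun e' => ⟨hp.nonneg e', hp.le_one e'⟩) ∅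
  rw [disSum_empty, biForm_rootRowKernel] at hd
  linarith [hd]

omit [Fintype V] [DecidableEq V] in
/-- **`Φ₀₀ ≤ M` at `e` from the typed mark-row count.** -/
theorem phi00_le_M_of_markRowCount {ends : E → Sym2 V} {o a₁ a₂ b : V} {e : E}
    (h : MarkRowCount (R := R) ends o a₁ a₂ b e) (p : E → R) (hp : IsProbVec p) :
    bhkSlack (Function.update p e 0) ends o a₁ a₂ b ≤ mixedSlack p ends o a₁ a₂ b e := by
  have hd := disSum_nonneg_of_pinnedCount (markRowKernel (R := R) ends o a₁ a₂ b e) h p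
    (fun e' => ⟨hp.nonneg e', hp.le_one e'⟩) ∅
  rw [disSum_empty, biForm_markRowKernel] at hd
  linarith [hd]

omit [Fintype V] [DecidableEq V] in
/-- **`MinRowBHK` from the typed counts**: if at every edge one of the two class counts holds. -/
theorem minRowBHK_of_counts {ends : E → Sym2 V} {o a₁ a₂ b : V}
    (h : ∀ e : E, RootRowCount (R := R) ends o a₁ a₂ b e ∨ MarkRowCount (R := R) ends o a₁ a₂ b e) :
    MinRowBHK (R := R) ends o a₁ a₂ b := by
  intro p hp e
  rcases h e with hR | hM
  · exact (min_le_right _ _).trans (phi11_le_M_of_rootRowCount hR p hp)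
  · exact (min_le_left _ _).trans (phi00_le_M_of_markRowCount hM p hp)

/-- **(W-ROW-MIN) at every edge of every `a₃`-inactive instance from the typed class counts.** -/
theorem wrowMin_of_a3Inactive_of_counts (ends : E → Sym2 V) (o a₁ a₂ a₃ b : V)
    (hc : ∀ e : E, RootRowCount (R := R) ends o a₁ a₂ b e ∨ MarkRowCount (R := R) ends o a₁ a₂ b e)
    (h : ∀ ω : Config E, ¬ Conn ends ω a₁ a₃ ∧ ¬ Conn ends ω a₂ a₃)
    (p : E → R) (hp : IsProbVec p) (e : E) (τ : E → ℕ) (hτ : τ e = 1) :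
    p e * (1 - p e) ^ 2 * Gc (Function.update p e 0) ends o a₁ a₂ a₃ b ≤
        triSum p {e} τ (K3 ends o a₁ a₂ a₃ b) ∨
      p e * (1 - p e) ^ 2 * Gc (Function.update p e 1) ends o a₁ a₂ a₃ b ≤
        triSum p {e} τ (K3 ends o a₁ a₂ a₃ b) :=
  wrowMin_of_a3Inactive_of_minRowBHK ends o a₁ a₂ a₃ b (minRowBHK_of_counts hc) h p hp e τ hτ

end MinRowTyped

end CovForm

end Summit.Ventures.PercRepro2
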